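import Literature.AlgebraicGeometry.Frobenioids.PadicFrobenioidMonogenic
import HarnessLib

/-!
# Frobenioids II, Example 1.1 (ii): `p` is a constant section; the monogenic datum of `p` is the absolutely primitive one

Mochizuki, *The geometry of Frobenioids II*, Kyushu J. Math. **62** (2008) 401–460, §1, Example 1.1 (ii), p. 8
[cite: MochizukiFrdII2008, Ex 1.1 (ii) p.8]; [IUTchI] Ex. 3.3 (i) (`c = p_v`) vs. Ex. 3.2 (v) (`c = q_v`).

Companion of `PadicFrobenioidMonogenic.lean` (abc-iut-L1-t4): the hypothesis `Monogenic.IsConstantSection` is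
INHABITED over every base — by `c = p` (`Monogenic.isConstantSection_p`: field homomorphisms fix `p`, and
`v(p) < 1`) — and the monogenic datum it generates IS the absolutely primitive datum `Datum.prim` of
`PadicFrobenioidPrimitive.lean` (`Datum.monogenic_p_eq_prim`, definitionally). No new mathematics.
-/

noncomputable section

namespace Literature.AlgebraicGeometry.Frobenioids

namespace PadicFrd

open CategoryTheory Opposite Function ValuativeRel

universe v u

variable {D : Type u} [Category.{v} D] {p : ℕ} (base : D ⥤ PadicFld.{u} p)

/-- The section `A ↦ p ∈ O_{K_A}^⊳`. [cite: MochizukiFrdII2008, Ex 1.1 (ii) p.8] -/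
def Monogenic.pSection (A : D) : intNonzero (base.obj A).K := ⟨((p : ℕ) : (base.obj A).K), (base.obj A).p_mem⟩

/-- **`p` is a constant section** of non-units: the restriction maps fix `p` and `v(p) < 1` in every `p`-adic
field of the base. [cite: MochizukiFrdII2008, Ex 1.1 (ii) p.8] -/
theorem Monogenic.isConstantSection_p : Monogenic.IsConstantSection base (Monogenic.pSection base) where
  map_eq f := Subtype.ext (map_natCast (base.map f).alg p)
  not_isUnit A h := (base.obj A).p_lt.ne ((isUnit_intNonzero_iff _ _).mp h)

/-- The generator `ord(p) ⊗ 1` of the monogenic datum of `p` is `primGen`. [cite: MochizukiFrdII2008, Ex 1.1 (ii) p.8] -/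
theorem Monogenic.gen_pSection (A : D) : Monogenic.gen base (Monogenic.pSection base) A = primGen base A := rfl

variable [Fact p.Prime]

/-- **The monogenic datum generated by `p` is the absolutely primitive datum** (definitionally).
[cite: MochizukiFrdII2008, Ex 1.1 (ii) p.8] -/
theorem Datum.monogenic_p_eq_prim (hloc : ∀ A : D, (base.obj A).IsPadicLocal) (hc : IsConnected D)
    (he : IsTotallyEpimorphic D) :
    Datum.monogenic base (Monogenic.isConstantSection_p base) hloc hc he = Datum.prim base hloc hc he := rfl

/-- Hence the monogenic datum of `p` is absolutely primitive. [cite: MochizukiFrdII2008, Ex 1.1 (ii) p.8] -/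
theorem Datum.monogenic_p_isAbsolutelyPrimitive (hloc : ∀ A : D, (base.obj A).IsPadicLocal) (hc : IsConnected D)
    (he : IsTotallyEpimorphic D) :
    (Datum.monogenic base (Monogenic.isConstantSection_p base) hloc hc he).IsAbsolutelyPrimitive :=
  Datum.prim_isAbsolutelyPrimitive base hloc hc he

end PadicFrd

end Literature.AlgebraicGeometry.Frobenioids
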